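import Summits.QuantumFields.YangMills.Theorems.UnitScaleTiltProp7CentreBiharmonicDirichlet
import Summits.QuantumFields.YangMills.Theorems.UnitScaleTiltProp7SpectralSplit
import Summits.QuantumFields.YangMills.Theorems.UnitScaleTiltProp7GaugeDirPlaqK
import HarnessLib

/-!
# Route `UnitScaleTilt`, crux K1 «MinimiserStabilityRegPr» (stmt-QuantumFields-19200), route-R E′ growth side (S3) — THE SPECTRAL THRESHOLD SPLIT OF THE
# COVARIANT LAPLACIAN `Δ_U = D*_U D_U` ON `M_N(ℂ)`-VALUED SITE FIELDS AT A UNITARY BACKGROUND: every site field is `φ = s + f` with `s` SLOW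
# (`Σ|D_U s|² ≤ t·Σ|s|²`, `Σ|Δ_U s|² ≤ t·Σ|D_U s|²`) and `f` FAST (`t·Σ|f|² ≤ Σ|D_U f|²`), Hilbert–Schmidt mass and Dirichlet energy splitting exactly

Cell `ym3-torus`, width seat `ym3-torus-px17` (gen 2; offer «px17: SPECTRAL-LATTICE», namer ★ym-ust-19200-p1 g15).  THEOREMS ONLY (0 `def`, 0 `sorry`);
`--supports stmt-QuantumFields-19200`, count-neutral.  YM₃ on T³ is a ladder rung (R3), not the Clay problem; nothing here claims a stub, the crux, d = 4 or the mass gap.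

WHY.  ✓ `Prop7SpectralSplit.exists_slow_fast_decomposition` (★p1 g15) is the abstract finite-dimensional split of a positive symmetric operator at a threshold `t`;
its announced USE is `A := Δ_W` on `su(2)`-valued site fields with `t := λ* = c·e·ℓ⁻²`: the FAST part of a covariant Hodge potential is affordable by norms
(`Σ|f|² ≤ λ*⁻¹·Σ|D_W f|²`, so the `[F_W, f]` commutator channel of the curved ζ-row S3 is `e`-small), the SLOW part is booked against the curl energy `K` (RULING
g28-№2 (a), K-form `hKg`).  THIS FILE is that lattice reading, once, in the S3 row's own letters: the carrier `Site P i`, fibres `M_N(ℂ)`, transport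
`R(u)X = uXu⁻¹` by UNITARY units (✓ `B9Eq39Adjoint.covD ∕ covDstar ∕ divB` at the torus shifts `torusT P i`), the Hilbert–Schmidt pairing `Re tr(XᴴY)`, and
`Δ_Uφ := divB (torusT P i) U (fun μ y => covD (torusT P i) U μ φ y)` (the letters of ✓ `Prop7CentreBiharmonicDirichlet` ∕ ✓ `Prop7CovHodgeSplit`).  The site fields are read in
the real Euclidean space of their entry coordinates (real and imaginary parts), where `Δ_U` is symmetric (✓ `Prop7CentreBiharmonicDirichlet.sum_trace_lap_symm`) and
nonnegative (`⟨φ, Δ_Uφ⟩ = Σ_{μ,x}|D_{U,μ}φ(x)|²_HS`, ✓ `…sum_trace_conjTranspose_lap_mul`); the eight abstract rows are transported back letter for letter.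

WHAT IS PROVED (ns `…Theorems.Prop7CovLaplaceSpectralSplit`; `U : Fin P.d → Site P i → (M_N(ℂ))ˣ` unitary-valued; `|X|²_HS = Σ_{ab} normSq X_{ab}`).
* §1 `divB_add`, `divB_smul`, `lap_add`, `lap_smul` (linearity of `D*_U`, `Δ_U`); `re_trace_conjTranspose_mul_eq_sum_re_im` (`Re tr(MᴴB)` in real coordinates).
* §2 ★★ `exists_slow_fast_siteField` — for every `t` and `φ`: `φ = s + f`, `Re Σ tr(sᴴf) = 0`, `Re Σ tr((D_Us)ᴴ D_Uf) = 0`, `Σ|φ|² = Σ|s|² + Σ|f|²`,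
  `Σ|D_Uφ|² = Σ|D_Us|² + Σ|D_Uf|²`, `Σ|D_Us|² ≤ t·Σ|s|²`, `Σ|Δ_Us|² ≤ t·Σ|D_Us|²`, `t·Σ|f|² ≤ Σ|D_Uf|²`, `Σ|Δ_Us|² + Σ|Δ_Uf|² = Σ|Δ_Uφ|²`.
* §3 ★ `sum_normSq_fast_le` (`0 < t`: `Σ|f|²_HS ≤ t⁻¹·Σ|D_Uf|²_HS`, and the operator-norm site mass `Σ_x‖f x‖² ≤ t⁻¹·Σ|D_Uf|²_HS` that ✓ `Prop7GaugeDirPlaqK.plaqK_gaugeDir_le_sites`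
  books into `K_W`); ★★ `exists_slow_fast_siteField_T3` — the reading on run `K` of a T³ family at an `SU(2)` background `W` (`unitsField (toUField W)`), bond sums `Σ_b`.
HONEST SCOPE.  Finite-dimensional linear algebra at an exact unitary background; no window, no constant of Bałaban's; the slow-sector booking (K-form) is NOT here.

References: T. Bałaban, CMP 99 (1985) 389–434 [Balaban1985BackgroundPropagators] ((3.3) p.390, (3.8) p.392, (3.117)–(3.122) pp.419–420, Thm 3.11 p.416);
CMP 102 (1985) 277–309 [Balaban1985Variational] ((79) p.290, (141)–(143) p.299, Prop. 7 p.299).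
-/

set_option autoImplicit false

noncomputable section

open scoped BigOperators Matrix.Norms.L2Operator Matrix InnerProductSpace

namespace Summit.QuantumFields.YangMills.Theorems.Prop7CovLaplaceSpectralSplit

open Literature.MathematicalPhysics.QuantumFieldTheory.Balaban1983to89
open B9Eq39Adjoint (covD covDstar divB covD_add covD_smul covDstar_add covDstar_smul)
open Literature.MathematicalPhysics.QuantumFieldTheory.Balaban1983to89.T3ContinuumYM3Torus
open B9TorusCalculus (torusT)
open B10Eq27TorusAxialLog (unitsField toUField)
open Summit.QuantumFields.YangMills.Theorems.Prop7CovariantCoercivity (re_trace_conjTranspose_mul_self)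
open Summit.QuantumFields.YangMills.Theorems.Prop7GaugeDirPlaqK (plaqK_gaugeDir_le_sites)
open Summit.QuantumFields.YangMills.Theorems.Prop7CovHodgeSplit (trace_conjTranspose_mul_eq_sum unitsField_toUField_mem_unitary sum_dir_site_eq_sum_pbond)
open Summit.QuantumFields.YangMills.Theorems.Prop7CentreBiharmonicDirichlet (sum_trace_conjTranspose_lap_mul sum_trace_lap_symm)
open Summit.QuantumFields.YangMills.Theorems.Prop7SpectralSplit (exists_slow_fast_decomposition)

variable {P : Params} {i : ℕ} {N : ℕ} (U : Fin P.d → Site P i → (Matrix (Fin N) (Fin N) ℂ)ˣ)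

/-! ## §1 Linearity of `D*_U` and `Δ_U`; the Hilbert–Schmidt pairing in real coordinates -/

section Linear

/-- `D*_U(A + B) = D*_U A + D*_U B`. [cite: Balaban1985BackgroundPropagators, (3.8) p.392] -/
theorem divB_add (A B : Fin P.d → Site P i → Matrix (Fin N) (Fin N) ℂ) (x : Site P i) :
    divB (torusT P i) U (fun μ y => A μ y + B μ y) x = divB (torusT P i) U A x + divB (torusT P i) U B x := by
  simp only [divB, ← Finset.sum_add_distrib]
  exact Finset.sum_congr rfl fun μ _ => covDstar_add (torusT P i) U μ (A μ) (B μ) x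

/-- `D*_U(c·A) = c·D*_U A`. [cite: Balaban1985BackgroundPropagators, (3.8) p.392] -/
theorem divB_smul (c : ℂ) (A : Fin P.d → Site P i → Matrix (Fin N) (Fin N) ℂ) (x : Site P i) :
    divB (torusT P i) U (fun μ y => c • A μ y) x = c • divB (torusT P i) U A x := by
  simp only [divB, Finset.smul_sum]
  exact Finset.sum_congr rfl fun μ _ => covDstar_smul (torusT P i) U c μ (A μ) x

/-- `Δ_U(φ + ψ) = Δ_Uφ + Δ_Uψ`. [cite: Balaban1985BackgroundPropagators, (3.3) p.390, (3.8) p.392] -/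
theorem lap_add (φ ψ : Site P i → Matrix (Fin N) (Fin N) ℂ) (x : Site P i) :
    divB (torusT P i) U (fun μ y => covD (torusT P i) U μ (fun z => φ z + ψ z) y) x
      = divB (torusT P i) U (fun μ y => covD (torusT P i) U μ φ y) x + divB (torusT P i) U (fun μ y => covD (torusT P i) U μ ψ y) x := by
  rw [← divB_add]
  congr 1
  funext μ y
  exact covD_add (torusT P i) U μ φ ψ y

/-- `Δ_U(c·φ) = c·Δ_Uφ`. [cite: Balaban1985BackgroundPropagators, (3.3) p.390, (3.8) p.392] -/
theorem lap_smul (c : ℂ) (φ : Site P i → Matrix (Fin N) (Fin N) ℂ) (x : Site P i) :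
    divB (torusT P i) U (fun μ y => covD (torusT P i) U μ (fun z => c • φ z) y) x
      = c • divB (torusT P i) U (fun μ y => covD (torusT P i) U μ φ y) x := by
  rw [← divB_smul]
  congr 1
  funext μ y
  exact covD_smul (torusT P i) U c μ φ y

/-- `Re tr(MᴴB) = Σ_{ab} (Re M_{ab}·Re B_{ab} + Im M_{ab}·Im B_{ab})` — the Hilbert–Schmidt pairing is the Euclidean pairing of the real entry coordinates. [folklore] -/
theorem re_trace_conjTranspose_mul_eq_sum_re_im (M B : Matrix (Fin N) (Fin N) ℂ) :
    ((Mᴴ * B).trace).re = ∑ a : Fin N, ∑ b : Fin N, ((M a b).re * (B a b).re + (M a b).im * (B a b).im) := by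
  rw [trace_conjTranspose_mul_eq_sum, Complex.re_sum]
  refine Finset.sum_congr rfl fun a _ => ?_
  rw [Complex.re_sum]
  refine Finset.sum_congr rfl fun b _ => ?_
  simp only [Complex.mul_re, Complex.conj_re, Complex.conj_im]
  ring

end Linear

/-! ## §2 The slow ∕ fast split of a site field -/

section Split

/-- ★★ **THE SPECTRAL THRESHOLD SPLIT OF `Δ_U` ON SITE FIELDS.**  At a unitary background `U`, for every threshold `t` and every `M_N(ℂ)`-valued site field `φ` there are
site fields `s` (slow) and `f` (fast) with `φ = s + f`, HS-orthogonal (`Re Σ_x tr(s(x)ᴴf(x)) = 0`) and `Δ_U`-orthogonal (`Re Σ_{x,μ} tr((D_{U,μ}s)ᴴ D_{U,μ}f) = 0`), the mass and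
the Dirichlet energy splitting exactly, and: `Σ|D_Us|² ≤ t·Σ|s|²`, `Σ|Δ_Us|² ≤ t·Σ|D_Us|²` (the covariant Laplacian nearly kills the slow part), `t·Σ|f|² ≤ Σ|D_Uf|²` (Poincaré with
constant `t⁻¹` on the fast part), `Σ|Δ_Us|² + Σ|Δ_Uf|² = Σ|Δ_Uφ|²` (all `|·|²` Hilbert–Schmidt).  (= ✓ `Prop7SpectralSplit.exists_slow_fast_decomposition` at `A := Δ_U` read in the real
Euclidean space of entry coordinates.) [cite: Balaban1985BackgroundPropagators, (3.117)-(3.122) pp.419-420, Thm 3.11 p.416, (3.8) p.392; Balaban1985Variational, (141)-(143) p.299] -/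
theorem exists_slow_fast_siteField
    (hU : ∀ (μ : Fin P.d) (x : Site P i), (U μ x : Matrix (Fin N) (Fin N) ℂ) ∈ unitary (Matrix (Fin N) (Fin N) ℂ))
    (t : ℝ) (φ : Site P i → Matrix (Fin N) (Fin N) ℂ) :
    ∃ s f : Site P i → Matrix (Fin N) (Fin N) ℂ,
      (∀ x, φ x = s x + f x) ∧
      (∑ x : Site P i, ((s x)ᴴ * f x).trace).re = 0 ∧
      (∑ x : Site P i, ∑ μ : Fin P.d, ((covD (torusT P i) U μ s x)ᴴ * covD (torusT P i) U μ f x).trace).re = 0 ∧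
      ∑ x : Site P i, ∑ a : Fin N, ∑ b : Fin N, Complex.normSq (φ x a b)
        = ∑ x : Site P i, ∑ a : Fin N, ∑ b : Fin N, Complex.normSq (s x a b) + ∑ x : Site P i, ∑ a : Fin N, ∑ b : Fin N, Complex.normSq (f x a b) ∧
      ∑ μ : Fin P.d, ∑ x : Site P i, ∑ a : Fin N, ∑ b : Fin N, Complex.normSq (covD (torusT P i) U μ φ x a b)
        = ∑ μ : Fin P.d, ∑ x : Site P i, ∑ a : Fin N, ∑ b : Fin N, Complex.normSq (covD (torusT P i) U μ s x a b)
          + ∑ μ : Fin P.d, ∑ x : Site P i, ∑ a : Fin N, ∑ b : Fin N, Complex.normSq (covD (torusT P i) U μ f x a b) ∧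
      ∑ μ : Fin P.d, ∑ x : Site P i, ∑ a : Fin N, ∑ b : Fin N, Complex.normSq (covD (torusT P i) U μ s x a b)
        ≤ t * ∑ x : Site P i, ∑ a : Fin N, ∑ b : Fin N, Complex.normSq (s x a b) ∧
      ∑ x : Site P i, ∑ a : Fin N, ∑ b : Fin N, Complex.normSq (divB (torusT P i) U (fun μ y => covD (torusT P i) U μ s y) x a b)
        ≤ t * ∑ μ : Fin P.d, ∑ x : Site P i, ∑ a : Fin N, ∑ b : Fin N, Complex.normSq (covD (torusT P i) U μ s x a b) ∧
      t * ∑ x : Site P i, ∑ a : Fin N, ∑ b : Fin N, Complex.normSq (f x a b)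
        ≤ ∑ μ : Fin P.d, ∑ x : Site P i, ∑ a : Fin N, ∑ b : Fin N, Complex.normSq (covD (torusT P i) U μ f x a b) ∧
      ∑ x : Site P i, ∑ a : Fin N, ∑ b : Fin N, Complex.normSq (divB (torusT P i) U (fun μ y => covD (torusT P i) U μ s y) x a b)
          + ∑ x : Site P i, ∑ a : Fin N, ∑ b : Fin N, Complex.normSq (divB (torusT P i) U (fun μ y => covD (torusT P i) U μ f y) x a b)
        = ∑ x : Site P i, ∑ a : Fin N, ∑ b : Fin N, Complex.normSq (divB (torusT P i) U (fun μ y => covD (torusT P i) U μ φ y) x a b) := by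
  classical
  -- real entry coordinates of site fields: `Q ⊕ Q`, `Q = sites × entries`, first copy the real parts, second copy the imaginary parts
  set crd : (Site P i → Matrix (Fin N) (Fin N) ℂ) → ((Site P i × Fin N × Fin N) ⊕ (Site P i × Fin N × Fin N) → ℝ) :=
    fun ψ => Sum.elim (fun q => (ψ q.1 q.2.1 q.2.2).re) (fun q => (ψ q.1 q.2.1 q.2.2).im) with hcrd
  set unc : ((Site P i × Fin N × Fin N) ⊕ (Site P i × Fin N × Fin N) → ℝ) → (Site P i → Matrix (Fin N) (Fin N) ℂ) :=
    fun g x => Matrix.of fun a b => (⟨g (Sum.inl (x, a, b)), g (Sum.inr (x, a, b))⟩ : ℂ) with hunc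
  have hunc_crd : ∀ ψ : Site P i → Matrix (Fin N) (Fin N) ℂ, unc (crd ψ) = ψ := by
    intro ψ; funext x; ext a b
    simp [hunc, hcrd]
  have hcrd_unc : ∀ g : (Site P i × Fin N × Fin N) ⊕ (Site P i × Fin N × Fin N) → ℝ, crd (unc g) = g := by
    intro g; funext j
    rcases j with ⟨x, a, b⟩ | ⟨x, a, b⟩
    · simp [hunc, hcrd]
    · simp [hunc, hcrd]
  have hcrd_add : ∀ ψ ψ' : Site P i → Matrix (Fin N) (Fin N) ℂ, crd (fun x => ψ x + ψ' x) = crd ψ + crd ψ' := by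
    intro ψ ψ'; funext j
    rcases j with ⟨x, a, b⟩ | ⟨x, a, b⟩
    · simp [hcrd]
    · simp [hcrd]
  have hcrd_smul : ∀ (r : ℝ) (ψ : Site P i → Matrix (Fin N) (Fin N) ℂ), crd (fun x => (r : ℂ) • ψ x) = r • crd ψ := by
    intro r ψ; funext j
    rcases j with ⟨x, a, b⟩ | ⟨x, a, b⟩
    · simp [hcrd]
    · simp [hcrd]
  have hunc_add : ∀ g g' : (Site P i × Fin N × Fin N) ⊕ (Site P i × Fin N × Fin N) → ℝ, unc (g + g') = fun x => unc g x + unc g' x := by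
    intro g g'; funext x; ext a b
    simp [hunc, Complex.ext_iff]
  have hunc_smul : ∀ (r : ℝ) (g : (Site P i × Fin N × Fin N) ⊕ (Site P i × Fin N × Fin N) → ℝ), unc (r • g) = fun x => (r : ℂ) • unc g x := by
    intro r g; funext x; ext a b
    simp [hunc, Complex.ext_iff, Matrix.smul_apply]
  -- the operator `Δ_U` in coordinates, an `ℝ`-linear endomorphism of the Euclidean space
  set lap : (Site P i → Matrix (Fin N) (Fin N) ℂ) → (Site P i → Matrix (Fin N) (Fin N) ℂ) :=
    fun ψ x => divB (torusT P i) U (fun μ y => covD (torusT P i) U μ ψ y) x with hlap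
  have hlap_add : ∀ ψ ψ' : Site P i → Matrix (Fin N) (Fin N) ℂ, lap (fun x => ψ x + ψ' x) = fun x => lap ψ x + lap ψ' x :=
    fun ψ ψ' => funext fun x => lap_add U ψ ψ' x
  have hlap_smul : ∀ (c : ℂ) (ψ : Site P i → Matrix (Fin N) (Fin N) ℂ), lap (fun x => c • ψ x) = fun x => c • lap ψ x :=
    fun c ψ => funext fun x => lap_smul U c ψ x
  let V := EuclideanSpace ℝ ((Site P i × Fin N × Fin N) ⊕ (Site P i × Fin N × Fin N))
  let A : V →ₗ[ℝ] V :=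
    { toFun := fun v => WithLp.toLp 2 (crd (lap (unc (WithLp.ofLp v))))
      map_add' := by
        intro v w
        rw [WithLp.ofLp_add, hunc_add, hlap_add, hcrd_add, WithLp.toLp_add]
      map_smul' := by
        intro r v
        rw [WithLp.ofLp_smul, hunc_smul, hlap_smul, hcrd_smul, WithLp.toLp_smul, RingHom.id_apply] }
  have hAdef : ∀ v : V, A v = WithLp.toLp 2 (crd (lap (unc (WithLp.ofLp v)))) := fun v => rfl
  -- coordinate readings
  have hinner : ∀ ψ ψ' : Site P i → Matrix (Fin N) (Fin N) ℂ,
      ⟪(WithLp.toLp 2 (crd ψ) : V), (WithLp.toLp 2 (crd ψ') : V)⟫_ℝ = (∑ x : Site P i, ((ψ x)ᴴ * ψ' x).trace).re := by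
    intro ψ ψ'
    rw [PiLp.inner_apply, Fintype.sum_sum_type, Complex.re_sum]
    simp only [hcrd, Sum.elim_inl, Sum.elim_inr, RCLike.inner_apply, conj_trivial]
    rw [← Finset.sum_add_distrib, Fintype.sum_prod_type]
    refine Finset.sum_congr rfl fun x _ => ?_
    rw [re_trace_conjTranspose_mul_eq_sum_re_im, Fintype.sum_prod_type]
    refine Finset.sum_congr rfl fun a _ => Finset.sum_congr rfl fun b _ => ?_
    dsimp only
    ring
  have hnorm : ∀ ψ : Site P i → Matrix (Fin N) (Fin N) ℂ,
      ‖(WithLp.toLp 2 (crd ψ) : V)‖ ^ 2 = ∑ x : Site P i, ∑ a : Fin N, ∑ b : Fin N, Complex.normSq (ψ x a b) := by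
    intro ψ
    rw [EuclideanSpace.real_norm_sq_eq, Fintype.sum_sum_type]
    simp only [hcrd, Sum.elim_inl, Sum.elim_inr]
    rw [← Finset.sum_add_distrib, Fintype.sum_prod_type]
    refine Finset.sum_congr rfl fun x _ => ?_
    rw [Fintype.sum_prod_type]
    refine Finset.sum_congr rfl fun a _ => Finset.sum_congr rfl fun b _ => ?_
    dsimp only
    rw [Complex.normSq_apply]
    ring
  have hA : ∀ ψ : Site P i → Matrix (Fin N) (Fin N) ℂ, A (WithLp.toLp 2 (crd ψ)) = WithLp.toLp 2 (crd (lap ψ)) := by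
    intro ψ
    rw [hAdef, WithLp.ofLp_toLp, hunc_crd]
  have hrepr : ∀ v : V, ∃ ψ : Site P i → Matrix (Fin N) (Fin N) ℂ, v = WithLp.toLp 2 (crd ψ) := by
    intro v
    refine ⟨unc (WithLp.ofLp v), ?_⟩
    rw [hcrd_unc, WithLp.toLp_ofLp]
  have henergy : ∀ ψ ψ' : Site P i → Matrix (Fin N) (Fin N) ℂ,
      ⟪A (WithLp.toLp 2 (crd ψ)), (WithLp.toLp 2 (crd ψ') : V)⟫_ℝ
        = (∑ x : Site P i, ∑ μ : Fin P.d, ((covD (torusT P i) U μ ψ x)ᴴ * covD (torusT P i) U μ ψ' x).trace).re := by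
    intro ψ ψ'
    rw [hA, hinner, hlap]
    exact congrArg Complex.re (sum_trace_conjTranspose_lap_mul U hU ψ ψ')
  have henergy_self : ∀ ψ : Site P i → Matrix (Fin N) (Fin N) ℂ,
      ⟪A (WithLp.toLp 2 (crd ψ)), (WithLp.toLp 2 (crd ψ) : V)⟫_ℝ
        = ∑ μ : Fin P.d, ∑ x : Site P i, ∑ a : Fin N, ∑ b : Fin N, Complex.normSq (covD (torusT P i) U μ ψ x a b) := by
    intro ψ
    rw [henergy, Complex.re_sum, Finset.sum_comm]
    refine Finset.sum_congr rfl fun μ _ => ?_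
    rw [Complex.re_sum]
    refine Finset.sum_congr rfl fun x _ => ?_
    rw [re_trace_conjTranspose_mul_self]
    exact Finset.sum_congr rfl fun a _ => Finset.sum_congr rfl fun b _ => Complex.sq_norm _
  have hlap2 : ∀ ψ : Site P i → Matrix (Fin N) (Fin N) ℂ,
      ‖A (WithLp.toLp 2 (crd ψ))‖ ^ 2 = ∑ x : Site P i, ∑ a : Fin N, ∑ b : Fin N, Complex.normSq (lap ψ x a b) := by
    intro ψ
    rw [hA, hnorm]
  -- symmetry and positivity of `Δ_U` in the real Hilbert–Schmidt geometry
  have hsym : A.IsSymmetric := by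
    intro v w
    obtain ⟨ψ, rfl⟩ := hrepr v
    obtain ⟨ψ', rfl⟩ := hrepr w
    rw [hA, hA, hinner, hinner, hlap]
    exact congrArg Complex.re (sum_trace_lap_symm U hU ψ ψ')
  have hpos : ∀ v : V, 0 ≤ ⟪A v, v⟫_ℝ := by
    intro v
    obtain ⟨ψ, rfl⟩ := hrepr v
    rw [henergy_self]
    exact Finset.sum_nonneg fun _ _ => Finset.sum_nonneg fun _ _ => Finset.sum_nonneg fun _ _ => Finset.sum_nonneg fun _ _ => Complex.normSq_nonneg _
  -- the abstract split, read back
  obtain ⟨s', f', hyf, horth, horthA, hmass, hen, hslow, hslow2, hfast, hlapsum⟩ :=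
    exists_slow_fast_decomposition hsym hpos t (WithLp.toLp 2 (crd φ) : V)
  obtain ⟨s, rfl⟩ := hrepr s'
  obtain ⟨f, rfl⟩ := hrepr f'
  refine ⟨s, f, ?_, ?_, ?_, ?_, ?_, ?_, ?_, ?_, ?_⟩
  · -- `φ = s + f`
    have h1 : unc (WithLp.ofLp (WithLp.toLp 2 (crd φ) : V)) = unc (WithLp.ofLp ((WithLp.toLp 2 (crd s) : V) + WithLp.toLp 2 (crd f))) := by
      rw [hyf]
    rw [WithLp.ofLp_add, WithLp.ofLp_toLp, WithLp.ofLp_toLp, WithLp.ofLp_toLp, hunc_add, hunc_crd, hunc_crd, hunc_crd] at h1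
    exact fun x => congrFun h1 x
  · rw [hinner] at horth
    exact horth
  · rw [henergy] at horthA
    exact horthA
  · rw [hnorm, hnorm, hnorm] at hmass
    exact hmass
  · rw [henergy_self, henergy_self, henergy_self] at hen
    exact hen
  · rw [henergy_self, hnorm] at hslow
    exact hslow
  · rw [hlap2, henergy_self] at hslow2
    exact hslow2
  · rw [hnorm, henergy_self] at hfast
    exact hfast
  · rw [hlap2, hlap2, hlap2] at hlapsum
    exact hlapsum

end Split

/-! ## §3 The fast-sector bookings and the T³ reading -/

section Fast

/-- ★ **THE FAST-SECTOR MASS IS ENERGY-BOOKED**: if `t·Σ|f|²_HS ≤ Σ|D_Uf|²_HS` (the fast row of ✓ `exists_slow_fast_siteField`) and `0 < t`, then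
`Σ_x|f(x)|²_HS ≤ t⁻¹·Σ_{μ,x}|D_{U,μ}f(x)|²_HS` and, in the operator norm the door's `K_W` bookings use, `Σ_x‖f(x)‖² ≤ t⁻¹·Σ_{μ,x}|D_{U,μ}f(x)|²_HS`
(`‖X‖² ≤ |X|²_HS`, lit `MatrixNorms.opNorm_sq_le_sum_norm_sq`). [cite: Balaban1985BackgroundPropagators, (3.117)-(3.122) pp.419-420, Thm 3.11 p.416] -/
theorem sum_normSq_fast_le {t : ℝ} (ht : 0 < t) (f : Site P i → Matrix (Fin N) (Fin N) ℂ)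
    (hfast : t * ∑ x : Site P i, ∑ a : Fin N, ∑ b : Fin N, Complex.normSq (f x a b)
      ≤ ∑ μ : Fin P.d, ∑ x : Site P i, ∑ a : Fin N, ∑ b : Fin N, Complex.normSq (covD (torusT P i) U μ f x a b)) :
    ∑ x : Site P i, ∑ a : Fin N, ∑ b : Fin N, Complex.normSq (f x a b)
        ≤ t⁻¹ * ∑ μ : Fin P.d, ∑ x : Site P i, ∑ a : Fin N, ∑ b : Fin N, Complex.normSq (covD (torusT P i) U μ f x a b) ∧
      ∑ x : Site P i, ‖f x‖ ^ 2 ≤ t⁻¹ * ∑ μ : Fin P.d, ∑ x : Site P i, ∑ a : Fin N, ∑ b : Fin N, Complex.normSq (covD (torusT P i) U μ f x a b) := by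
  have h1 : ∑ x : Site P i, ∑ a : Fin N, ∑ b : Fin N, Complex.normSq (f x a b)
      ≤ t⁻¹ * ∑ μ : Fin P.d, ∑ x : Site P i, ∑ a : Fin N, ∑ b : Fin N, Complex.normSq (covD (torusT P i) U μ f x a b) := by
    rw [inv_mul_eq_div, le_div_iff₀ ht, mul_comm]
    exact hfast
  refine ⟨h1, (Finset.sum_le_sum fun x _ => ?_).trans h1⟩
  exact (MatrixNorms.opNorm_sq_le_sum_norm_sq (f x)).trans
    (le_of_eq (Finset.sum_congr rfl fun a _ => Finset.sum_congr rfl fun b _ => Complex.sq_norm _))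

variable [NeZero N]

/-- ★★ **THE FAST HALF OF THE K-FORM ROW `hKg`**: at an `SU(N)` background `W` with `dist1(W(∂p)) ≤ a` on every plaquette (the plaquette clause of (6)(e), `a = eℓ⁻²`),
a site field `f` in the FAST sector of `Δ_W` at threshold `t` (`t·Σ|f|²_HS ≤ Σ|D_Wf|²_HS`) has its gauge direction `Z^f_b = f(b₋) − W_b f(b₊) W_b^*` booked in the door's
linearised-curvature energy by the Dirichlet energy alone: `K_W(Z^f) ≤ 4a²·d²·t⁻¹·Σ_{μ,x}|D_{W,μ}f(x)|²_HS` (✓ `Prop7GaugeDirPlaqK.plaqK_gaugeDir_le_sites` ∘ `sum_normSq_fast_le`;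
at `t = λ* = c·e·ℓ⁻²` the coefficient is `4d²(e∕c)·ℓ⁻²` — `e`-small).  The SLOW sector is not booked here (K-form, RULING g28-№2 (a)).
[cite: Balaban1985Variational, (6) p.278, (47)-(48) pp.285-286, (141)-(143) p.299; Balaban1985BackgroundPropagators, (3.4) p.391, (3.117)-(3.122) pp.419-420] -/
theorem plaqK_gaugeDir_fast_le (W : GaugeField P i (Matrix.specialUnitaryGroup (Fin N) ℂ)) {a t : ℝ}
    (hW : ∀ p : Plaq P i, dist1 (GaugeField.plaqHol W p) ≤ a) (ht : 0 < t) (f : Site P i → Matrix (Fin N) (Fin N) ℂ)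
    (hfast : t * ∑ x : Site P i, ∑ a : Fin N, ∑ b : Fin N, Complex.normSq (f x a b)
      ≤ ∑ μ : Fin P.d, ∑ x : Site P i, ∑ a : Fin N, ∑ b : Fin N,
          Complex.normSq (covD (torusT P i) (fun κ z => unitsField (toUField W) ⟨z, κ⟩) μ f x a b))
    (Z : PBond P i → Matrix (Fin N) (Fin N) ℂ)
    (hZ : ∀ b : PBond P i, Z b = f b.src - (W b : Matrix (Fin N) (Fin N) ℂ) * f (b.src.shift b.dir) * star (W b : Matrix (Fin N) (Fin N) ℂ)) :
    (∑ p : Plaq P i, ‖((Complex.I • Z ⟨p.src, p.μ⟩)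
          + ((W ⟨p.src, p.μ⟩ : Matrix (Fin N) (Fin N) ℂ) * (Complex.I • Z ⟨p.src.shift p.μ, p.ν⟩) * star (W ⟨p.src, p.μ⟩ : Matrix (Fin N) (Fin N) ℂ))
          - (((W ⟨p.src, p.μ⟩ * W ⟨p.src.shift p.μ, p.ν⟩ * (W ⟨p.src.shift p.ν, p.μ⟩)⁻¹ : Matrix.specialUnitaryGroup (Fin N) ℂ) : Matrix (Fin N) (Fin N) ℂ)
              * (Complex.I • Z ⟨p.src.shift p.ν, p.μ⟩)
              * star ((W ⟨p.src, p.μ⟩ * W ⟨p.src.shift p.μ, p.ν⟩ * (W ⟨p.src.shift p.ν, p.μ⟩)⁻¹ : Matrix.specialUnitaryGroup (Fin N) ℂ) : Matrix (Fin N) (Fin N) ℂ))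
          - (((GaugeField.plaqHol W p : Matrix.specialUnitaryGroup (Fin N) ℂ) : Matrix (Fin N) (Fin N) ℂ) * (Complex.I • Z ⟨p.src, p.ν⟩)
              * star ((GaugeField.plaqHol W p : Matrix.specialUnitaryGroup (Fin N) ℂ) : Matrix (Fin N) (Fin N) ℂ)))‖ ^ 2)
      ≤ 4 * a ^ 2 * ((P.d : ℝ) ^ 2 * (t⁻¹ * ∑ μ : Fin P.d, ∑ x : Site P i, ∑ a : Fin N, ∑ b : Fin N,
          Complex.normSq (covD (torusT P i) (fun κ z => unitsField (toUField W) ⟨z, κ⟩) μ f x a b))) :=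
  (plaqK_gaugeDir_le_sites W hW f Z hZ).trans
    (mul_le_mul_of_nonneg_left (mul_le_mul_of_nonneg_left (sum_normSq_fast_le (fun κ z => unitsField (toUField W) ⟨z, κ⟩) ht f hfast).2
      (by positivity)) (by positivity))

end Fast

section T3

/-- ★★ **THE SLOW ∕ FAST SPLIT ON THE T³ CARRIER** (run `K` of a T³ family, `SU(2)` background `W` read as `unitsField (toUField W)`, bond sums `Σ_b`): for every `t` and every
`M₂(ℂ)`-valued site field `φ` on the finest torus, `φ = s + f` with `Σ_b|D_Wφ|² = Σ_b|D_Ws|² + Σ_b|D_Wf|²`, `Σ|φ|² = Σ|s|² + Σ|f|²`, `Σ_b|D_Ws|² ≤ t·Σ|s|²`, `Σ|Δ_Ws|² ≤ t·Σ_b|D_Ws|²`,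
`t·Σ|f|² ≤ Σ_b|D_Wf|²`, `Σ|Δ_Ws|² + Σ|Δ_Wf|² = Σ|Δ_Wφ|²` (all Hilbert–Schmidt) — the lattice reading of ✓ `Prop7SpectralSplit.exists_slow_fast_decomposition` at `A := Δ_W`
for the route-R S3 bookkeeping. [cite: Balaban1985BackgroundPropagators, (3.117)-(3.122) pp.419-420, Thm 3.11 p.416; Balaban1985Variational, (141)-(143) p.299, Prop. 7 p.299] -/
theorem exists_slow_fast_siteField_T3 (F : T3Family) (K : ℕ) (W : GaugeField (F.P K) 0 (Matrix.specialUnitaryGroup (Fin 2) ℂ)) (t : ℝ)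
    (φ : Site (F.P K) 0 → Matrix (Fin 2) (Fin 2) ℂ) :
    ∃ s f : Site (F.P K) 0 → Matrix (Fin 2) (Fin 2) ℂ,
      (∀ x, φ x = s x + f x) ∧
      ∑ x : Site (F.P K) 0, ∑ a : Fin 2, ∑ b : Fin 2, Complex.normSq (φ x a b)
        = ∑ x : Site (F.P K) 0, ∑ a : Fin 2, ∑ b : Fin 2, Complex.normSq (s x a b) + ∑ x : Site (F.P K) 0, ∑ a : Fin 2, ∑ b : Fin 2, Complex.normSq (f x a b) ∧
      ∑ b : PBond (F.P K) 0, ∑ a : Fin 2, ∑ b' : Fin 2, Complex.normSq (covD (torusT (F.P K) 0) (fun κ z => unitsField (toUField W) ⟨z, κ⟩) b.dir φ b.src a b')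
        = ∑ b : PBond (F.P K) 0, ∑ a : Fin 2, ∑ b' : Fin 2, Complex.normSq (covD (torusT (F.P K) 0) (fun κ z => unitsField (toUField W) ⟨z, κ⟩) b.dir s b.src a b')
          + ∑ b : PBond (F.P K) 0, ∑ a : Fin 2, ∑ b' : Fin 2, Complex.normSq (covD (torusT (F.P K) 0) (fun κ z => unitsField (toUField W) ⟨z, κ⟩) b.dir f b.src a b') ∧
      ∑ b : PBond (F.P K) 0, ∑ a : Fin 2, ∑ b' : Fin 2, Complex.normSq (covD (torusT (F.P K) 0) (fun κ z => unitsField (toUField W) ⟨z, κ⟩) b.dir s b.src a b')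
        ≤ t * ∑ x : Site (F.P K) 0, ∑ a : Fin 2, ∑ b : Fin 2, Complex.normSq (s x a b) ∧
      ∑ x : Site (F.P K) 0, ∑ a : Fin 2, ∑ b : Fin 2, Complex.normSq (divB (torusT (F.P K) 0) (fun κ z => unitsField (toUField W) ⟨z, κ⟩)
          (fun κ y => covD (torusT (F.P K) 0) (fun κ z => unitsField (toUField W) ⟨z, κ⟩) κ s y) x a b)
        ≤ t * ∑ b : PBond (F.P K) 0, ∑ a : Fin 2, ∑ b' : Fin 2, Complex.normSq (covD (torusT (F.P K) 0) (fun κ z => unitsField (toUField W) ⟨z, κ⟩) b.dir s b.src a b') ∧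
      t * ∑ x : Site (F.P K) 0, ∑ a : Fin 2, ∑ b : Fin 2, Complex.normSq (f x a b)
        ≤ ∑ b : PBond (F.P K) 0, ∑ a : Fin 2, ∑ b' : Fin 2, Complex.normSq (covD (torusT (F.P K) 0) (fun κ z => unitsField (toUField W) ⟨z, κ⟩) b.dir f b.src a b') ∧
      ∑ x : Site (F.P K) 0, ∑ a : Fin 2, ∑ b : Fin 2, Complex.normSq (divB (torusT (F.P K) 0) (fun κ z => unitsField (toUField W) ⟨z, κ⟩)
            (fun κ y => covD (torusT (F.P K) 0) (fun κ z => unitsField (toUField W) ⟨z, κ⟩) κ s y) x a b)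
          + ∑ x : Site (F.P K) 0, ∑ a : Fin 2, ∑ b : Fin 2, Complex.normSq (divB (torusT (F.P K) 0) (fun κ z => unitsField (toUField W) ⟨z, κ⟩)
            (fun κ y => covD (torusT (F.P K) 0) (fun κ z => unitsField (toUField W) ⟨z, κ⟩) κ f y) x a b)
        = ∑ x : Site (F.P K) 0, ∑ a : Fin 2, ∑ b : Fin 2, Complex.normSq (divB (torusT (F.P K) 0) (fun κ z => unitsField (toUField W) ⟨z, κ⟩)
            (fun κ y => covD (torusT (F.P K) 0) (fun κ z => unitsField (toUField W) ⟨z, κ⟩) κ φ y) x a b) := by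
  obtain ⟨s, f, hsum, -, -, hmass, hen, hslow, hslow2, hfast, hlap⟩ :=
    exists_slow_fast_siteField (fun κ z => unitsField (toUField W) ⟨z, κ⟩) (unitsField_toUField_mem_unitary W) t φ
  refine ⟨s, f, hsum, hmass, ?_, ?_, ?_, ?_, hlap⟩
  · rw [sum_dir_site_eq_sum_pbond (fun b : PBond (F.P K) 0 => ∑ a : Fin 2, ∑ b' : Fin 2,
        Complex.normSq (covD (torusT (F.P K) 0) (fun κ z => unitsField (toUField W) ⟨z, κ⟩) b.dir φ b.src a b')),
      sum_dir_site_eq_sum_pbond (fun b : PBond (F.P K) 0 => ∑ a : Fin 2, ∑ b' : Fin 2,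
        Complex.normSq (covD (torusT (F.P K) 0) (fun κ z => unitsField (toUField W) ⟨z, κ⟩) b.dir s b.src a b')),
      sum_dir_site_eq_sum_pbond (fun b : PBond (F.P K) 0 => ∑ a : Fin 2, ∑ b' : Fin 2,
        Complex.normSq (covD (torusT (F.P K) 0) (fun κ z => unitsField (toUField W) ⟨z, κ⟩) b.dir f b.src a b'))] at hen
    exact hen
  · rw [sum_dir_site_eq_sum_pbond (fun b : PBond (F.P K) 0 => ∑ a : Fin 2, ∑ b' : Fin 2,
        Complex.normSq (covD (torusT (F.P K) 0) (fun κ z => unitsField (toUField W) ⟨z, κ⟩) b.dir s b.src a b'))] at hslow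
    exact hslow
  · rw [sum_dir_site_eq_sum_pbond (fun b : PBond (F.P K) 0 => ∑ a : Fin 2, ∑ b' : Fin 2,
        Complex.normSq (covD (torusT (F.P K) 0) (fun κ z => unitsField (toUField W) ⟨z, κ⟩) b.dir s b.src a b'))] at hslow2
    exact hslow2
  · rw [sum_dir_site_eq_sum_pbond (fun b : PBond (F.P K) 0 => ∑ a : Fin 2, ∑ b' : Fin 2,
        Complex.normSq (covD (torusT (F.P K) 0) (fun κ z => unitsField (toUField W) ⟨z, κ⟩) b.dir f b.src a b'))] at hfast
    exact hfast

end T3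

end Summit.QuantumFields.YangMills.Theorems.Prop7CovLaplaceSpectralSplit

end
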